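import Mathlib
import Summits.Ventures.HodgeRepro.Tier4.Line4.ProjDataSeesaw
import Summits.Ventures.HodgeRepro.Tier4.Common.LocalTorusCompactConj

/-!
# Tier4/Line4/ProjDataSeesawClosed — the projector data of the seesaw plane with NO compactness binder: typer-2's
`isCompact_localTorusAt'_seesaw` (LocalTorusCompactConj p689818) discharges `hcompT`

Blind re-derivation cell `pub-hodge-repro`, Tier 4 «prove the step» (README §9–§10), seat t4-L4-p2 (prover, LINE L4,
gen 3; the `hgood` binder of v0.26/v0.27's example (xi), plan-4 S14047, typer-2 S14128). Tree path
`lean/Summits/Ventures/HodgeRepro/Tier4/Line4/ProjDataSeesawClosed.lean`. Mathlib-level; no literature. Inputs: this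
seat's `Line4/ProjDataSeesaw` (`seesawOf`, `seesawNu`, `seesawNuK`, `good_projData_seesaw`), typer-2's
`Common/LocalTorusCompactConj` (`isCompact_localTorusAt'_seesaw`).

* `hcompT_seesaw` — the compactness of every local torus of `T′` on the seesaw plane (real CM places);
* `seesawNu'` — the normalised Haar measures with the compactness discharged;
* **`good_projData_seesaw'`** — every datum of `projData (seesawOf …) q g g' eP' eM' (seesawNu' …) K (seesawNuK K hKc)`
  is good from `a 1 ≠ 0`, `a 3 ≠ 0`, the similitude (`λ ≠ 0`), `∀ w, w.IsReal`, `∀ w, IsCMAt q w` and a compact level —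
  the binder `hgood` of example (xi) with NOTHING displayed beyond the wall's own algebraic binders and the two
  place conditions.

Nothing here says anything about the status of the Hodge conjecture for CM abelian varieties, which is NOT proved
(HC_CM is NOT proved by anyone in this repository).
-/

set_option autoImplicit false

noncomputable section

namespace Summit.Ventures.HodgeRepro.Tier4.Line4

open Summit.Ventures.HodgeRepro.Tier4.Common Summit.Ventures.HodgeRepro.Tier4.Line1 MeasureTheory NumberField
  Matrix
open scoped ComplexConjugate

section SeesawClosed

variable {k : Type} [Field k] [NumberField k] (q : QuadData k) (a : Fin 4 → k)
  (g g' : Matrix (Fin 4) (Fin 4) k) (hgg' : g * g' = 1) (hg'g : g' * g = 1)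
  (hgΩ : g * (PlaneData.mixedRow q (a 0) (a 2)).Ω = (PlaneData.mixedRow q (a 0) (a 2)).Ω * g)
  [MeasurableSpace (GA (seesawOf q a g g' hgg' hg'g hgΩ))] [BorelSpace (GA (seesawOf q a g g' hgg' hg'g hgΩ))]

omit [MeasurableSpace (GA (seesawOf q a g g' hgg' hg'g hgΩ))] [BorelSpace (GA (seesawOf q a g g' hgg' hg'g hgΩ))] in
/-- **`hcompT` is a theorem** (02:4xZ): the local tori of `T′` on the seesaw plane are compact — typer-2's
`Common.isCompact_localTorusAt'_seesaw` (LocalTorusCompactConj p689818) at every real CM place. -/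
theorem hcompT_seesaw (ha1 : a 1 ≠ 0) (ha3 : a 3 ≠ 0) (lam : k) (hlam : lam ≠ 0)
    (hiso : g * (PlaneData.mixedRow q (a 1) (a 3)).B * gᵀ = lam • (PlaneData.mixedRow q (a 0) (a 2)).B)
    (hreal : ∀ w : InfinitePlace k, w.IsReal) (hcm : ∀ w : InfinitePlace k, IsCMAt q w) :
    ∀ w : InfinitePlace k,
      IsCompact (localTorusAt' (seesawOf q a g g' hgg' hg'g hgΩ) w : Set (GA (seesawOf q a g g' hgg' hg'g hgΩ))) :=
  fun w => isCompact_localTorusAt'_seesaw q a g g' hgg' hg'g hgΩ lam hlam hiso ha1 ha3 (hreal w) (hcm w)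

/-- The normalised Haar measures of the local tori of `T′`, with the compactness discharged. -/
def seesawNu' (ha1 : a 1 ≠ 0) (ha3 : a 3 ≠ 0) (lam : k) (hlam : lam ≠ 0)
    (hiso : g * (PlaneData.mixedRow q (a 1) (a 3)).B * gᵀ = lam • (PlaneData.mixedRow q (a 0) (a 2)).B)
    (hreal : ∀ w : InfinitePlace k, w.IsReal) (hcm : ∀ w : InfinitePlace k, IsCMAt q w) (w : InfinitePlace k) :
    Measure (localTorusAt' (seesawOf q a g g' hgg' hg'g hgΩ) w) :=
  seesawNu q a g g' hgg' hg'g hgΩ (hcompT_seesaw q a g g' hgg' hg'g hgΩ ha1 ha3 lam hlam hiso hreal hcm) w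

/-- **Every datum of the seesaw plane's projector is good — no compactness binder left**: from `a 1 ≠ 0`, `a 3 ≠ 0`, the
similitude, the real CM places and a compact level `K`. -/
theorem good_projData_seesaw' (ha1 : a 1 ≠ 0) (ha3 : a 3 ≠ 0) (lam : k) (hlam : lam ≠ 0)
    (hiso : g * (PlaneData.mixedRow q (a 1) (a 3)).B * gᵀ = lam • (PlaneData.mixedRow q (a 0) (a 2)).B)
    (hreal : ∀ w : InfinitePlace k, w.IsReal) (hcm : ∀ w : InfinitePlace k, IsCMAt q w)
    (K : Subgroup (GA (seesawOf q a g g' hgg' hg'g hgΩ)))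
    (hKc : IsCompact (K : Set (GA (seesawOf q a g g' hgg' hg'g hgΩ)))) (eP' eM' : InfinitePlace k → ℤ) :
    ∀ d ∈ projData (seesawOf q a g g' hgg' hg'g hgΩ) q g g' eP' eM'
      (seesawNu' q a g g' hgg' hg'g hgΩ ha1 ha3 lam hlam hiso hreal hcm) K
      (seesawNuK q a g g' hgg' hg'g hgΩ K hKc), d.Good :=
  good_projData_seesaw q a g g' hgg' hg'g hgΩ ha1 ha3 lam hlam hiso hreal hcm
    (hcompT_seesaw q a g g' hgg' hg'g hgΩ ha1 ha3 lam hlam hiso hreal hcm) K hKc eP' eM'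

end SeesawClosed

end Summit.Ventures.HodgeRepro.Tier4.Line4

end
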